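import Mathlib
import Literature.AlgebraicGeometry.Motives.EtaleTate
import HarnessLib

/-!
# Invariant tensors of an abstract subgroup of `GL(V)`: fixed spaces, invariant ranks,
# tensor-reductivity and tensor-connectedness

For a field `F`, an `F`-vector space `V` and an ABSTRACT subgroup `K ≤ GL(V) = (V ≃ₗ[F] V)` we
record the elementary vocabulary of "tensors fixed by `K`" in the mixed tensor spaces
`T^{a,b} V = V^{⊗a} ⊗ (V^∨)^{⊗b}` (Deligne, *Hodge cycles on abelian varieties*, LNM 900, I §3,
set-up of Prop. 3.1: for `H ≤ G ≤ GL(V)` one considers "the subgroup of `G` fixing all tensors,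
occurring in some `T^{m,n}`, that are fixed by `H`"):

* `Subgroup.tensorFixedSpace K a b ≤ T^{a,b} V` — the subspace `(T^{a,b} V)^K` of `K`-fixed
  tensors, `⨅ g ∈ K, eqLocus (g ↦ g·) id`;
* `Subgroup.tensorInvariantRank K N = dim_F (T^{N,N} V)^K` — the **invariant rank**: the dimension
  of the `K`-fixed subspace of `T^{N,N} V = V^{⊗N} ⊗ (V^∨)^{⊗N}` (`≅ End(V^{⊗N})` for `V`
  finite-dimensional), i.e. `dim End_K(V^{⊗N})`;
* `Subgroup.IsTensorReductive K` — every `K`-stable subspace of every `T^{a,b} V` has a `K`-stable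
  complement (all the `K`-modules `T^{a,b} V` are semisimple);
* `Subgroup.IsTensorConnected K` — every finite-index subgroup `K' ≤ K` (`K'.relIndex K ≠ 0`,
  Mathlib's convention: infinite index is `relIndex = 0`) fixes exactly the tensors `K` fixes.

The carriers are the tree's `hodgeTensorSpaceOver F V a b = (⨂[F]^a V) ⊗[F] (⨂[F]^b (Module.Dual F V))`
with the action `tensorSpaceActOver g = g^{⊗a} ⊗ ((g⁻¹)^∨)^{⊗b}` (`Literature.AlgebraicGeometry.Motives`,
file `EtaleTate.lean`; as a linear map it is
`TensorProduct.map (PiTensorProduct.map fun _ ↦ g) (PiTensorProduct.map fun _ ↦ g.symm.dualMap)` by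
`coe_tensorSpaceActOver`, `rfl`) — NOT redefined here.

## Why these notions (informal; nothing of this paragraph is asserted formally)

Let `Ḡ ≤ GL(V)` be the Zariski closure of `K` (`V` finite-dimensional). Stabilisers of subspaces
and fixators of vectors are Zariski closed, so `K`-stable subspaces / `K`-fixed tensors of `T^{a,b} V`
are the `Ḡ`-stable / `Ḡ`-fixed ones. Hence `IsTensorReductive K` says that all the algebraic
representations `T^{a,b} V` of `Ḡ` are semisimple; as every finite-dimensional representation of
`Ḡ` is a subquotient of a finite sum of `T^{a,b} V`'s (Deligne, loc. cit., I Prop. 3.1 (a) and its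
proof, after Waterhouse 3.5), this is linear reductivity of `Ḡ` (= reductivity in characteristic
`0`). If `Ḡ` is connected then `IsTensorConnected K` holds (a finite-index subgroup of `K` is
Zariski dense in `Ḡ`); conversely, if `K` is tensor-reductive and tensor-connected then `Ḡ°` and
`Ḡ` fix the same tensors, so `Ḡ° = Ḡ` by Deligne's criterion I Prop. 3.1 (c) ("if `H` is
reductive then `H = H'`", `H'` = the subgroup of `G` fixing the tensors fixed by `H`). These are the
hypotheses (RED)/(CONN) under which route HodgeConjecture/MomentAmplification (cruxes `HalfOrAll`,
`BettiBridge`) counts invariants of abstract matrix groups; that route inlines them with a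
let-bound `act`, and `Literature.AlgebraicGeometry.Motives.MotivatedGaloisGroupCounts` names the
special case `F = ℂ`, `V = Fin d → ℂ` (`IsCompletelyReducibleOnMixedTensors`,
`FiniteIndexSubgroupsFixSameTensors`, `mixedTensorInvariantsFinrank`). The present file is the
general-field, general-`V` form requested as `Subgroup.tensorInvariantRank` (ledger item
`defn-Subgroup.tensorInvariantRank`); the `ℂ^d` predicates are literally its instances
(`IsCompletelyReducibleOnMixedTensors K ↔ K.IsTensorReductive` and
`FiniteIndexSubgroupsFixSameTensors M ↔ M.IsTensorConnected` by `Iff.rfl`,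
`mixedTensorInvariantsFinrank K N = K.tensorInvariantRank N` by `rfl` — checked in a scratch file;
the bridging lemmas are not stated here so that the import direction stays
Motives-specific → general, i.e. that file may later import this one).

## API

`mem_tensorFixedSpace_iff`, `tensorFixedSpace_anti` (bigger group, fewer invariants),
`tensorFixedSpace_bot = ⊤`, `tensorInvariantRank_anti`, `isTensorReductive_iff` (membership form),
`isTensorConnected_iff` (fixed-space form), `isTensorConnected_iff_finiteIndex`,
`IsTensorConnected.tensorFixedSpace_eq / tensorInvariantRank_eq`, non-vacuity
`isTensorReductive_bot`, `isTensorConnected_bot`, `tensorInvariantRank_bot`.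

## Mathlib / tree searches

Mathlib has `Representation.invariants` (for a `Representation k G V`, not for a `Subgroup` of
`V ≃ₗ V` acting on tensor spaces), no linear reductivity predicate for abstract matrix groups and no
Zariski closure in `GL(V)` (`lean search 'IsLinearlyReductive|invariantRank|tensorInvariant'`: nothing).
The tree has the carriers and action (`EtaleTate.lean`), the stabiliser-of-tensors subgroups
`tensorStabilizerOver` (the dual notion: group from tensors; here: tensors from group) and the `ℂ^d`
predicates quoted above. Dot notation: the declarations live in
`Literature.RepresentationTheory.GeneralLinear.Subgroup.*`; after
`open Literature.RepresentationTheory.GeneralLinear` one writes `K.tensorInvariantRank N`,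
`K.IsTensorReductive`, `K.IsTensorConnected`.

## References

* P. Deligne, *Hodge cycles on abelian varieties* (notes by J. S. Milne), in *Hodge Cycles, Motives,
  and Shimura Varieties*, LNM 900, Springer 1982, I §3, Prop. 3.1 (a)–(c) and Remark 3.2.
  [Deligne1982HodgeCycles]
-/

noncomputable section

open scoped TensorProduct PiTensorProduct

namespace Literature.RepresentationTheory.GeneralLinear

open Literature.AlgebraicGeometry.Motives

-- Dot notation `K.tensorFixedSpace`, `K.IsTensorReductive`, … for `K : Subgroup (V ≃ₗ[F] V)`
-- resolves `Subgroup.<name>` through OPEN namespaces (not through the enclosing one), so the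
-- file opens its own namespace, exactly as users do.
open Literature.RepresentationTheory.GeneralLinear

universe u v

variable {F : Type u} [Field F] {V : Type v} [AddCommGroup V] [Module F V]

/-! ### Fixed tensors and the invariant rank -/

/-- The **space of `K`-fixed tensors** `(T^{a,b} V)^K ≤ T^{a,b} V = V^{⊗a} ⊗ (V^∨)^{⊗b}` of an
abstract subgroup `K ≤ GL(V)`: the tensors `t` with `g · t = t` for all `g ∈ K`, where
`g · = tensorSpaceActOver g = g^{⊗a} ⊗ ((g⁻¹)^∨)^{⊗b}`; written as the infimum over `g ∈ K` of the
equalisers `eqLocus (g ·) id` (the shape inlined by route HodgeConjecture/MomentAmplification).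
Deliberately declared as `Subgroup.tensorFixedSpace` inside this file's namespace (dot notation
`K.tensorFixedSpace a b` after `open Literature.RepresentationTheory.GeneralLinear`).
[cite: Deligne1982HodgeCycles, I §3, Prop. 3.1 (set-up)] -/
def Subgroup.tensorFixedSpace (K : Subgroup (V ≃ₗ[F] V)) (a b : ℕ) :
    Submodule F (hodgeTensorSpaceOver F V a b) :=
  ⨅ g ∈ K, LinearMap.eqLocus (tensorSpaceActOver (a := a) (b := b) g :
    hodgeTensorSpaceOver F V a b →ₗ[F] hodgeTensorSpaceOver F V a b) LinearMap.id

/-- Unfolding of `Subgroup.tensorFixedSpace` (definitional). [folklore] -/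
theorem Subgroup.tensorFixedSpace_def (K : Subgroup (V ≃ₗ[F] V)) (a b : ℕ) :
    K.tensorFixedSpace a b =
      ⨅ g ∈ K, LinearMap.eqLocus (tensorSpaceActOver (a := a) (b := b) g :
        hodgeTensorSpaceOver F V a b →ₗ[F] hodgeTensorSpaceOver F V a b) LinearMap.id :=
  rfl

/-- Membership in the fixed space: `t ∈ (T^{a,b} V)^K ↔ ∀ g ∈ K, g · t = t`. [folklore] -/
@[simp]
theorem Subgroup.mem_tensorFixedSpace_iff (K : Subgroup (V ≃ₗ[F] V)) {a b : ℕ}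
    (t : hodgeTensorSpaceOver F V a b) :
    t ∈ K.tensorFixedSpace a b ↔ ∀ g ∈ K, tensorSpaceActOver (a := a) (b := b) g t = t := by
  simp only [Subgroup.tensorFixedSpace, Submodule.mem_iInf, LinearMap.mem_eqLocus,
    LinearEquiv.coe_coe, LinearMap.id_coe, id_eq]

/-- A bigger group has fewer fixed tensors: `K ≤ K' → (T^{a,b})^{K'} ≤ (T^{a,b})^K`. [folklore] -/
theorem Subgroup.tensorFixedSpace_anti {K K' : Subgroup (V ≃ₗ[F] V)} (h : K ≤ K') (a b : ℕ) :
    K'.tensorFixedSpace a b ≤ K.tensorFixedSpace a b := fun t ht ↦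
  (K.mem_tensorFixedSpace_iff t).2 fun g hg ↦ (K'.mem_tensorFixedSpace_iff t).1 ht g (h hg)

/-- The trivial group fixes every tensor. [folklore] -/
@[simp]
theorem Subgroup.tensorFixedSpace_bot (a b : ℕ) :
    (⊥ : Subgroup (V ≃ₗ[F] V)).tensorFixedSpace a b = ⊤ := by
  refine eq_top_iff.2 fun t _ ↦ (Subgroup.mem_tensorFixedSpace_iff ⊥ t).2 fun g hg ↦ ?_
  rw [Subgroup.mem_bot] at hg
  subst hg
  rw [tensorSpaceActOver_one]
  rfl

/-- The **invariant rank** `INV_K(N) := dim_F (T^{N,N} V)^K` of an abstract subgroup `K ≤ GL(V)`: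
the dimension of the space of `K`-fixed tensors in `T^{N,N} V = V^{⊗N} ⊗ (V^∨)^{⊗N}` (for `V`
finite-dimensional `T^{N,N} V ≅ End(V^{⊗N})` equivariantly, so this is `dim End_K(V^{⊗N})`, the
`2N`-th moment of the character of `K` on `V` when `K` is compact). `Module.finrank`, hence `0` if
the fixed space is infinite-dimensional. Requested by route HodgeConjecture/MomentAmplification
(`HalfOrAll`, `BettiBridge`: the sequences `N ↦ INV_M(N)`, `INV_G(N)`). Deliberate
`Subgroup.`-prefixed declaration in this file's namespace (dot notation `K.tensorInvariantRank N`).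
[cite: Deligne1982HodgeCycles, I §3, Prop. 3.1] -/
def Subgroup.tensorInvariantRank (K : Subgroup (V ≃ₗ[F] V)) (N : ℕ) : ℕ :=
  Module.finrank F ↥(K.tensorFixedSpace N N)

/-- Unfolding of `Subgroup.tensorInvariantRank` (definitional). [folklore] -/
theorem Subgroup.tensorInvariantRank_def (K : Subgroup (V ≃ₗ[F] V)) (N : ℕ) :
    K.tensorInvariantRank N = Module.finrank F ↥(K.tensorFixedSpace N N) :=
  rfl

/-- The invariant rank in the route-literal shape `finrank (⨅ g ∈ K, eqLocus (g ·) id)`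
(definitional). [folklore] -/
theorem Subgroup.tensorInvariantRank_eq_finrank_iInf (K : Subgroup (V ≃ₗ[F] V)) (N : ℕ) :
    K.tensorInvariantRank N =
      Module.finrank F ↥(⨅ g ∈ K, LinearMap.eqLocus (tensorSpaceActOver (a := N) (b := N) g :
        hodgeTensorSpaceOver F V N N →ₗ[F] hodgeTensorSpaceOver F V N N) LinearMap.id) :=
  rfl

/-- For `V` finite-dimensional, a bigger group has a smaller invariant rank:
`K ≤ K' → INV_{K'}(N) ≤ INV_K(N)`. [folklore] -/
theorem Subgroup.tensorInvariantRank_anti [Module.Finite F V] {K K' : Subgroup (V ≃ₗ[F] V)}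
    (h : K ≤ K') (N : ℕ) : K'.tensorInvariantRank N ≤ K.tensorInvariantRank N :=
  Submodule.finrank_mono (Subgroup.tensorFixedSpace_anti h N N)

/-- The invariant rank of the trivial group is the dimension of the whole tensor space
`T^{N,N} V`. [folklore] -/
theorem Subgroup.tensorInvariantRank_bot (N : ℕ) :
    (⊥ : Subgroup (V ≃ₗ[F] V)).tensorInvariantRank N =
      Module.finrank F (hodgeTensorSpaceOver F V N N) := by
  rw [Subgroup.tensorInvariantRank_def, Subgroup.tensorFixedSpace_bot, finrank_top]

/-! ### Tensor-reductivity (RED) and tensor-connectedness (CONN) -/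

/-- **Tensor-reductivity** of an abstract subgroup `K ≤ GL(V)` (RED): for all `a b`, every
`K`-stable subspace `W ≤ T^{a,b} V` (`g · W ≤ W` for `g ∈ K`, written `W ≤ W.comap (g ·)`) has a
`K`-stable complement `W'` (`IsCompl W W'`), i.e. every `T^{a,b} V` is a semisimple `K`-module.
For `V` finite-dimensional this is linear reductivity of the Zariski closure `Ḡ` of `K` (stable
subspaces are `Ḡ`-stable; every representation of `Ḡ` is a subquotient of a sum of `T^{a,b} V`'s,
Deligne I Prop. 3.1 (a)); in characteristic `0`, reductivity. The body is literally hypothesis (RED)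
of route HodgeConjecture/MomentAmplification and, at `F = ℂ`, `V = Fin d → ℂ`, the tree's
`IsCompletelyReducibleOnMixedTensors` (`Iff.rfl`). Deliberate `Subgroup.`-prefixed declaration in
this file's namespace (dot notation `K.IsTensorReductive`).
[cite: Deligne1982HodgeCycles, I §3, Prop. 3.1 (a), (c)] -/
def Subgroup.IsTensorReductive (K : Subgroup (V ≃ₗ[F] V)) : Prop :=
  ∀ (a b : ℕ) (W : Submodule F (hodgeTensorSpaceOver F V a b)),
    (∀ g ∈ K, W ≤ W.comap (tensorSpaceActOver (a := a) (b := b) g :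
        hodgeTensorSpaceOver F V a b →ₗ[F] hodgeTensorSpaceOver F V a b)) →
      ∃ W' : Submodule F (hodgeTensorSpaceOver F V a b),
        (∀ g ∈ K, W' ≤ W'.comap (tensorSpaceActOver (a := a) (b := b) g :
          hodgeTensorSpaceOver F V a b →ₗ[F] hodgeTensorSpaceOver F V a b)) ∧
        IsCompl W W'

/-- Membership form of tensor-reductivity: `K`-stability of `W` as `∀ g ∈ K, ∀ w ∈ W, g · w ∈ W`.
[folklore] -/
theorem Subgroup.isTensorReductive_iff (K : Subgroup (V ≃ₗ[F] V)) :
    K.IsTensorReductive ↔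
      ∀ (a b : ℕ) (W : Submodule F (hodgeTensorSpaceOver F V a b)),
        (∀ g ∈ K, ∀ w ∈ W, tensorSpaceActOver (a := a) (b := b) g w ∈ W) →
          ∃ W' : Submodule F (hodgeTensorSpaceOver F V a b),
            (∀ g ∈ K, ∀ w ∈ W', tensorSpaceActOver (a := a) (b := b) g w ∈ W') ∧ IsCompl W W' := by
  simp only [Subgroup.IsTensorReductive, SetLike.le_def, Submodule.mem_comap, LinearEquiv.coe_coe]

/-- The trivial subgroup is tensor-reductive (every subspace of a vector space has a complement,
`Submodule.exists_isCompl`). Non-vacuity witness. [folklore] -/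
theorem Subgroup.isTensorReductive_bot : (⊥ : Subgroup (V ≃ₗ[F] V)).IsTensorReductive := by
  intro a b W _
  obtain ⟨W', hW'⟩ := Submodule.exists_isCompl W
  refine ⟨W', fun g hg ↦ ?_, hW'⟩
  rw [Subgroup.mem_bot] at hg
  subst hg
  intro w hw
  rw [Submodule.mem_comap, tensorSpaceActOver_one]
  exact hw

/-- **Tensor-connectedness** of an abstract subgroup `K ≤ GL(V)` (CONN): every subgroup `K' ≤ K`
of finite index (`K'.relIndex K ≠ 0`; Mathlib sets `relIndex = 0` for infinite index) fixes
exactly the tensors that `K` fixes, in every `T^{a,b} V`. It holds when the Zariski closure `Ḡ`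
of `K` is connected (a finite-index subgroup of `K` is then Zariski dense in `Ḡ`); conversely, for
`K` tensor-reductive it forces `Ḡ° = Ḡ` by Deligne's criterion I Prop. 3.1 (c) (`H` reductive and
`H`, `G` fixing the same tensors ⇒ `H = G`, applied to `Ḡ° ≤ Ḡ`). The body is literally hypothesis
(CONN) of route HodgeConjecture/MomentAmplification and, at `F = ℂ`, `V = Fin d → ℂ`, the tree's
`FiniteIndexSubgroupsFixSameTensors` (`Iff.rfl`). Deliberate `Subgroup.`-prefixed declaration in
this file's namespace (dot notation `K.IsTensorConnected`).
[cite: Deligne1982HodgeCycles, I §3, Prop. 3.1 (c) and Remark 3.2 (a)] -/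
def Subgroup.IsTensorConnected (K : Subgroup (V ≃ₗ[F] V)) : Prop :=
  ∀ K' : Subgroup (V ≃ₗ[F] V), K' ≤ K → K'.relIndex K ≠ 0 →
    ∀ (a b : ℕ) (t : hodgeTensorSpaceOver F V a b),
      (∀ g ∈ K', tensorSpaceActOver (a := a) (b := b) g t = t) →
        ∀ g ∈ K, tensorSpaceActOver (a := a) (b := b) g t = t

/-- Fixed-space form of tensor-connectedness: finite-index subgroups have no extra fixed tensors,
`(T^{a,b})^{K'} ≤ (T^{a,b})^K` (the reverse inclusion is `tensorFixedSpace_anti`). [folklore] -/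
theorem Subgroup.isTensorConnected_iff (K : Subgroup (V ≃ₗ[F] V)) :
    K.IsTensorConnected ↔
      ∀ K' : Subgroup (V ≃ₗ[F] V), K' ≤ K → K'.relIndex K ≠ 0 →
        ∀ a b : ℕ, K'.tensorFixedSpace a b ≤ K.tensorFixedSpace a b := by
  refine ⟨fun h K' hK' hi a b t ht ↦ ?_, fun h K' hK' hi a b t ht ↦ ?_⟩
  · exact (K.mem_tensorFixedSpace_iff t).2 (h K' hK' hi a b t ((K'.mem_tensorFixedSpace_iff t).1 ht))
  · exact (K.mem_tensorFixedSpace_iff t).1 (h K' hK' hi a b ((K'.mem_tensorFixedSpace_iff t).2 ht))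

/-- Tensor-connectedness with the finite-index hypothesis phrased through Mathlib's class
`Subgroup.FiniteIndex` of `K'` viewed inside `K` (`K'.relIndex K = (K'.subgroupOf K).index`).
[folklore] -/
theorem Subgroup.isTensorConnected_iff_finiteIndex (K : Subgroup (V ≃ₗ[F] V)) :
    K.IsTensorConnected ↔
      ∀ K' : Subgroup (V ≃ₗ[F] V), K' ≤ K → (K'.subgroupOf K).FiniteIndex →
        ∀ a b : ℕ, K'.tensorFixedSpace a b ≤ K.tensorFixedSpace a b := by
  rw [Subgroup.isTensorConnected_iff]
  refine forall_congr' fun K' ↦ forall_congr' fun _ ↦ ?_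
  rw [Subgroup.finiteIndex_iff, Subgroup.relIndex]

/-- Under tensor-connectedness a finite-index subgroup has the same fixed tensors. [folklore] -/
theorem Subgroup.IsTensorConnected.tensorFixedSpace_eq {K K' : Subgroup (V ≃ₗ[F] V)}
    (h : K.IsTensorConnected) (hK' : K' ≤ K) (hi : K'.relIndex K ≠ 0) (a b : ℕ) :
    K'.tensorFixedSpace a b = K.tensorFixedSpace a b :=
  le_antisymm ((K.isTensorConnected_iff).1 h K' hK' hi a b) (Subgroup.tensorFixedSpace_anti hK' a b)

/-- Under tensor-connectedness a finite-index subgroup has the same invariant ranks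
`INV_{K'}(N) = INV_K(N)`. [folklore] -/
theorem Subgroup.IsTensorConnected.tensorInvariantRank_eq {K K' : Subgroup (V ≃ₗ[F] V)}
    (h : K.IsTensorConnected) (hK' : K' ≤ K) (hi : K'.relIndex K ≠ 0) (N : ℕ) :
    K'.tensorInvariantRank N = K.tensorInvariantRank N := by
  rw [Subgroup.tensorInvariantRank_def, Subgroup.tensorInvariantRank_def,
    h.tensorFixedSpace_eq hK' hi N N]

/-- The trivial subgroup is tensor-connected. Non-vacuity witness. [folklore] -/
theorem Subgroup.isTensorConnected_bot : (⊥ : Subgroup (V ≃ₗ[F] V)).IsTensorConnected := by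
  intro K' _ _ a b t _ g hg
  rw [Subgroup.mem_bot] at hg
  subst hg
  rw [tensorSpaceActOver_one]
  rfl

end Literature.RepresentationTheory.GeneralLinear

end
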